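import Summits.BirchSwinnertonDyer.BirchSwinnertonDyer.Theorems.GoldfeldAllTwistsTwoConverseTwinQuarterTraceIndexB4
import Summits.BirchSwinnertonDyer.BirchSwinnertonDyer.Theorems.GoldfeldAllTwistsTwoConverseTwinOddTwoPrimesTwistDescent
import Summits.BirchSwinnertonDyer.BirchSwinnertonDyer.Theorems.GoldfeldAllTwistsTwoConverseTwinQuarterTraceIndexB4POneSharp
import Summits.BirchSwinnertonDyer.BirchSwinnertonDyer.Theorems.GoldfeldAllTwistsTwoConverseTwinQuarterTraceIndexB4POneAlphaSharp
import HarnessLib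

set_option linter.dupNamespace false -- namespace `…BirchSwinnertonDyer.BirchSwinnertonDyer…` is the cell's (D-0017 nested layout)
set_option autoImplicit false

/-!
# OBJECT U (RULING (ccclxxi)), file U2: THE `q ≡ 7 (mod 8)` UNION CAPSTONE of the FORMULA AXIS — TYPE-FREE and `p`-MOD-`8`-FREE
# `BSD(W, 2)` for every globally minimal `W ≅ 49a1^{(−2qp)}` on C4 ∪ C8 ∪ C7 ∪ C7A from EIGHTEEN named prints, NO Cassels–Tate

Cell `bsd-goldfeld`, seat `bsd-goldfeld-s1p-c3x` (gen 13); planner RULING (ccclxxi)/(ccclxxii) ORDER «OBJECT U». `--supports stmt-BirchSwinnertonDyer-19140`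
as a HELPER. Theses-free; one theorem by cases, nothing else; 0 def, 0 new name, 0 new fact, no `sorry`.

THE UNION. The four closers are in the tree: C8 ⊂ C6 ∪ C8 (`p ≡ 5 (mod 8)`, TYPE β: B⁗ `bsdp_two_negTwoPrimesTwist_beta_of_print`), C4 (`p ≡ 5 (mod 8)`,
TYPE α: the `h2`-free closer `bsdp_two_negTwoPrimesTwist_alpha_of_print'`), C7 (`p ≡ 1 (mod 8)`, TYPE β: «C7 −hCT» `bsdp_two_negTwoPrimesTwist_betaPOne_of_print_sharp`)
and C7A (`p ≡ 1 (mod 8)`, TYPE α: F3 `bsdp_two_negTwoPrimesTwist_alphaPOne_of_print_sharp`) — every branch `hCT`-free. Hence, by `p ≡ 1 (mod 4) ⇒ p ≡ 1` or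
`5 (mod 8)` and excluded middle on «`−7` is a fourth power mod `p`»: for primes `q > 3`, `q ≡ 7 (mod 8)`, `(q/7) = −1`, `p ≡ 1 (mod 4)`, `(−7/p) = +1`,
`(p/q) = −1`: **`BSD(W, 2)` (Miller's `2`-part) for EVERY globally minimal elliptic `W/ℚ` isomorphic to `49a1^{(−2qp)}`** (and `r_an(W) = rank W(ℚ) = 1`
by file U1) — modulo EIGHTEEN named prints = the UNION BY NAME of the four branches' binders and NOTHING ELSE:
`hCST hGZ h12 h44 h13 h14 hS31 hnew hM hBT hBF hGZK hEta hEta₀ hD hBCST hpar hKo`; NO `hCT`.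
HONEST FRAMING: a twist-density-ZERO two-parameter family modulo eighteen named prints; FRONTIER-grade, never distance-to-summit; items 19140 / 19350 /
20044 unchanged and NOT closed; BSD is not proved by any of this.

References: [Miller2011LMS] Def. 1.1; [GrossZagier1986] Thm. I.(6.3), V.§2; [GrossLMS1991] §4 (4.1), Prop. 5.3; [CoatesLiTianZhai2015] Thm. 1.2–1.4, 4.4;
[CaiShuTian2014] Thm 1.1; [LiMa2008] Thm 0.4; [BurungaleCastellaSkinnerTian2022] Thm. A, Rem. D; [SilvermanAEC2009] Thm. X.4.2, X.4.9.
-/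

noncomputable section

open scoped Classical

open WeierstrassCurve NumberField Literature.NumberTheory Literature.NumberTheory.EllipticCurves
  Literature.NumberTheory.EllipticCurves.ModularForms Literature.NumberTheory.EllipticCurves.CaiShuTian2014
  Literature.NumberTheory.EllipticCurves.CoatesLiTianZhai2015

namespace Summit.BirchSwinnertonDyer.BirchSwinnertonDyer.Theorems.GoldfeldGoodTwists

section Union

variable (hCST : thm11_ringClassChar)
  (hGZ : ∀ (N : ℕ) [NeZero N] (W : WeierstrassCurve ℚ) (K : Type) [Field K] [NumberField K], gross_zagier N W K)
  (h12 : thm12_fullBSD_twist) (h44 : thm44_ord_two_LAlg) (h13 : thm13_ord_two_LAlg) (h14 : thm14_rankOne_twist)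
  (hS31 : bsdTriple_of_rank_le_one_of_conductor_lt) (hnew : exists_isNewformOf) (hM : OptimalCurveManinCertificate cm7)
  (hBT : burungaleTian_analyticRank_eq_zero_of_selmerCorank_eq_zero_of_hasCM) (hBF : bsdTriple_of_hasCM_of_L_one_ne_zero)
  (hGZK : rank_eq_analyticRank_of_analyticRank_le_one) (hEta : x049_heegner_norm_x_sub_two_not_mem)
  (hEta₀ : x049_x_sub_two_eq_etaQuotient) (hD : deuring_etaQuotient49_heegner_generates_conjPrime)
  (hBCST : BurungaleCastellaSkinnerTian2022.thmA_analyticRank_eq_one_of_selmerCorank_eq_one)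
  (hpar : ∀ (V : WeierstrassCurve ℚ) [V.IsElliptic], p_parity V 2)
  (hKo : ∀ (N : ℕ) [NeZero N] (W : WeierstrassCurve ℚ) (K : Type) [Field K] [NumberField K], kolyvagin N W K)
include hCST hGZ h12 h44 h13 h14 hS31 hnew hM hBT hBF hGZK hEta hEta₀ hD hBCST hpar hKo

/-- **`BSD(W, 2)` on the whole `q ≡ 7 (mod 8)` half (C4 ∪ C8 ∪ C7 ∪ C7A), FROM PRINT + KOLYVAGIN — no type condition, no residue of `p` mod `8`,
NO Cassels–Tate.** `q > 3` prime, `q ≡ 7 (mod 8)`, `(q/7) = −1`; `p ≡ 1 (mod 4)` prime, `(−7/p) = +1`; `(p/q) = −1`; `W/ℚ` globally minimal elliptic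
with `C • W = X₀(49)^{(−2qp)}` for some `C`: **`BSD(W, 2)`** — by cases `p ≡ 5 (8)` ∧ β (`bsdp_two_negTwoPrimesTwist_beta_of_print`) ∣ `p ≡ 5 (8)` ∧ α
(`bsdp_two_negTwoPrimesTwist_alpha_of_print'`) ∣ `p ≡ 1 (8)` ∧ β (`bsdp_two_negTwoPrimesTwist_betaPOne_of_print_sharp`) ∣ `p ≡ 1 (8)` ∧ α
(`bsdp_two_negTwoPrimesTwist_alphaPOne_of_print_sharp`), where β/α = «`−7` is / is not a fourth power mod `p`». EIGHTEEN print binders (the union of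
the branches' by name), nothing else. With U1: `BSD(W,2) ∧ r_an(W) = rank W(ℚ) = 1` for EVERY `W ≅ 49a1^{(−2qp)}` with `q ≡ 7 (8)`, `(q/7) = −1`,
`p ≡ 1 (4)`, `(−7/p) = +1`, `(p/q) = −1` — modulo eighteen named prints; a density-zero two-parameter family; FRONTIER-grade; items unchanged; BSD
is not proved by any of this. [cite: Miller2011LMS, Def. 1.1] [cite: GrossZagier1986, Thm. I.(6.3) and V.§2]
[cite: CoatesLiTianZhai2015, Thm. 1.2 (p. 359), 1.3, 1.4 and 4.4] [cite: LiMa2008, Thm. 0.4] [cite: BurungaleCastellaSkinnerTian2022, Thm. A (p. 326) and Rem. D (p. 327)]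
[cite: SilvermanAEC2009, Thm. X.4.14] -/
theorem bsdp_two_negTwoPrimesTwist_sevenModEight_modFour_of_print
    {q p : ℕ} (hq : q.Prime) (h3 : 3 < q) (hq8 : q % 8 = 7) (hq7 : jacobiSym q 7 = -1)
    [Fact p.Prime] (hp4 : p % 4 = 1) (hp7 : legendreSym p (-7) = 1) (hpq : jacobiSym (p : ℤ) q = -1)
    (W : WeierstrassCurve ℚ) [W.IsElliptic] [W.IsGloballyMinimal]
    (hC : ∃ C : VariableChange ℚ, C • W = cm7.quadraticTwist (-(2 * (q : ℚ) * p))) : BSDp W 2 := by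
  obtain ⟨C, hC⟩ := hC
  haveI := Fact.mk hq
  obtain hp8 | hp8 : p % 8 = 1 ∨ p % 8 = 5 := by omega
  · by_cases hβ : ∃ x : ZMod p, x ^ 4 = -7
    · exact bsdp_two_negTwoPrimesTwist_betaPOne_of_print_sharp hCST hGZ h12 h44 h13 h14 hS31 hnew hM hBF hGZK hEta hEta₀ hD hKo hq hq8 hq7 hp8
        hp7 hβ hpq W C hC
    · exact bsdp_two_negTwoPrimesTwist_alphaPOne_of_print_sharp hCST hGZ h12 h44 h14 hS31 hnew hM hBT hBF hGZK hEta hEta₀ hD hBCST hpar hKo hq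
        hq8 hq7 hp8 hp7 hβ hpq W C hC
  · by_cases hβ : ∃ x : ZMod p, x ^ 4 = -7
    · exact bsdp_two_negTwoPrimesTwist_beta_of_print hCST hGZ h12 h44 h13 h14 hS31 hnew hM hBT hBF hGZK hEta hEta₀ hD hKo hq h3 (by omega) hq7
        hp8 hp7 hβ hpq W C hC
    · exact bsdp_two_negTwoPrimesTwist_alpha_of_print' hCST hGZ h12 h44 h14 hS31 hnew hM hBT hBF hGZK hEta hEta₀ hD hKo hpar hBCST hq8 hq7 hp8
        hp7 hβ hpq W C hC

end Union

end Summit.BirchSwinnertonDyer.BirchSwinnertonDyer.Theorems.GoldfeldGoodTwists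

end
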